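import Summits.ValiantsHypothesis.ValiantsHypothesis.Theorems.KPlusLogSqLawStaticPathWalls
import Summits.ValiantsHypothesis.ValiantsHypothesis.Theorems.KPlusLogSqLawStaticPathMixedEvents

/-!
# Route «KPlusLogSqLaw» — parametric max-weight independent set on a path: SLOT ALTERNATION — hops ≤ jumps + masked⁺ + 2(n+1)

HONEST FRAMING.  Helper toward the crux `WeakLifting` (item `stmt-ValiantsHypothesis-19561`, route `KPlusLogSqLaw`, cell `pub-symmetroid`,
seat val-sym-lift-p4 g21, 2026-08-29) on the line of its witness-plan stub `stub_tridiagonalSectorB` (tropical twin of the STATIC tridiagonal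
sector = parametric maximum-weight independent set on a path).  Kernel form of §2b of the memo `HOME/val-sym-lift-p4/STEPS-AND-CROSSINGS.md`
(this seat): the (M)-partners `q > p` of a line `p` split into two SLOTS by the sign of the slope of their gap along `p` (which end of `p`'s window
they cut); along a slot, consecutive partners kill each other (`killer_eq_next`: the first later line incorrect at the vertex of `(p, q)` is the next
partner of the same slot, by one-dimensional affine reasoning as in `…StaticPathWalls`), so the R-FLIPS — partners whose killer has the other parity,
i.e. the (R)-clause of THEOREM T's events — ALTERNATE in parity along each slot (`parity_ne_of_nextFlip`).  Mapping every hop (same-parity event)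
that is not the last flip of its slot to the next flip of its slot is injective and lands in the jumps (mixed events) or in the MASKED⁺ pairs (mixed
flips failing (L) whose preceding flip is a hop); the last flips are at most one per slot.  Hence **`hops_le_jumps_add_masked`**:
`#hops ≤ #jumps + #masked⁺ + 2(n+1)`, and with THEOREM T (`mixedEvents_card_le`) **`hops_le_masked`**: `#hops ≤ 4n + 2 + #masked⁺` — the ORDER
QUESTION follows from «masked⁺ = O(n)» (located: masked⁺ ≤ 6 on all maximisers n ≤ 24, ≈ 0.7 n under direct annealing).  Statements about a
labelled line arrangement; nothing here asserts anything about `WeakLifting`, `TropicalB`, `KPlusLogSqLaw`, the stub in its window, `MatrixDescartes`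
(stmt-ValiantsHypothesis-18050) or `VP ≠ VNP`; the ORDER QUESTION stays open.
-/

set_option linter.dupNamespace false
set_option autoImplicit false

namespace Summit.ValiantsHypothesis.ValiantsHypothesis.Theorems.KPlusLogSqLaw

open Finset Classical

namespace StaticPathFold

noncomputable section

variable (a b : ℕ → ℝ)

/-! ## 1. Slots: one-dimensional lemmas along the base line -/

/-- the gap of `t` against `p` in point–slope form around the crossing of `p` and `t`. [folklore] -/
theorem gap_eq_slope_mul {p t : ℕ} (hA : a p ≠ a t) (θ : ℝ) :
    gap t (L a b p θ) (L a b t θ) =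
      (if Even t then a t - a p else a p - a t) * (θ - (b t - b p) / (a p - a t)) := by
  have h0 := gap_crossAbs_eq_zero a b hA
  rw [gap_along_line] at h0 ⊢
  linarith

/-- (G2) a later partner `q'` of the SAME slot as `q` is incorrect at the vertex of `(p, q)`. [folklore] -/
theorem not_correct_of_sameSlot {p q q' : ℕ} (hAq : a p ≠ a q) (hAq' : a p ≠ a q')
    (hside : (0 < (if Even q then a q - a p else a p - a q)) ↔ (0 < (if Even q' then a q' - a p else a p - a q')))
    (hcorr : 0 < gap q (L a b p ((b q' - b p) / (a p - a q'))) (L a b q ((b q' - b p) / (a p - a q')))) :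
    ¬ 0 < gap q' (L a b p ((b q - b p) / (a p - a q))) (L a b q' ((b q - b p) / (a p - a q))) := by
  rw [gap_eq_slope_mul a b hAq] at hcorr
  rw [gap_eq_slope_mul a b hAq']
  set s := (if Even q then a q - a p else a p - a q) with hs
  set s' := (if Even q' then a q' - a p else a p - a q') with hs'
  set τ := (b q - b p) / (a p - a q)
  set τ' := (b q' - b p) / (a p - a q')
  have hs0 : s ≠ 0 := by rw [hs]; split_ifs <;> [exact sub_ne_zero.mpr (Ne.symm hAq); exact sub_ne_zero.mpr hAq]
  have hs0' : s' ≠ 0 := by rw [hs']; split_ifs <;> [exact sub_ne_zero.mpr (Ne.symm hAq'); exact sub_ne_zero.mpr hAq']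
  intro h
  -- `s (τ' - τ) > 0` and `s' (τ - τ') > 0` with `s, s'` of the same sign: impossible
  rcases lt_trichotomy 0 s with hsp | hsz | hsn
  · have hsp' : 0 < s' := hside.mp hsp
    nlinarith
  · exact hs0 hsz.symm
  · have hsn' : ¬ 0 < s' := fun hh => absurd (hside.mpr hh) (not_lt.mpr hsn.le)
    have hsn'' : s' < 0 := lt_of_le_of_ne (not_lt.mp hsn') hs0'
    nlinarith

/-- (G3) if the killer `c` of `(p, q)` (incorrect at the vertex, everything in `(p, c)` other than `q` correct there) is followed by a partner
`q' > c` of `p`, then `c` is itself a partner of `p` (every line of `(p, c)` is correct at the vertex of `(p, c)`). [folklore] -/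
theorem partner_of_killer {p q c q' : ℕ} (hpq : p < q) (hqc : q < c) (hcq' : c < q')
    (hAq : a p ≠ a q) (hAc : a p ≠ a c)
    (hMq : ∀ t, p < t → t < c → t ≠ q → 0 < gap t (L a b p ((b q - b p) / (a p - a q))) (L a b t ((b q - b p) / (a p - a q))))
    (hbad : gap c (L a b p ((b q - b p) / (a p - a q))) (L a b c ((b q - b p) / (a p - a q))) < 0)
    (hMq' : ∀ t, p < t → t < q' → 0 < gap t (L a b p ((b q' - b p) / (a p - a q'))) (L a b t ((b q' - b p) / (a p - a q')))) :
    ∀ t, p < t → t < c → 0 < gap t (L a b p ((b c - b p) / (a p - a c))) (L a b t ((b c - b p) / (a p - a c))) := by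
  set τq := (b q - b p) / (a p - a q) with hτq
  set τc := (b c - b p) / (a p - a c) with hτc
  set τ' := (b q' - b p) / (a p - a q') with hτ'
  -- `τc` lies strictly between `τq` and `τ'`: the gap of `c` is negative at `τq`, zero at `τc`, positive at `τ'`
  have hc' : 0 < gap c (L a b p τ') (L a b c τ') := hMq' c (by omega) hcq'
  have ec := gap_eq_slope_mul a b hAc
  intro t hpt htc
  have ht' : 0 < gap t (L a b p τ') (L a b t τ') := hMq' t hpt (by omega)
  by_cases htq : t = q
  · -- the partner `q` itself: gap zero at `τq`, positive at `τ'`, affine ⇒ positive at `τc` (strictly between)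
    subst htq
    have eq0 : gap t (L a b p τq) (L a b t τq) = 0 := gap_crossAbs_eq_zero a b hAq
    have e1 := gap_along_line a b p t τq
    have e2 := gap_along_line a b p t τc
    have e3 := gap_along_line a b p t τ'
    have f1 := ec τq
    have f2 := ec τ'
    -- sign bookkeeping with the slope `sc` of `c`'s gap and `st` of `t`'s gap
    set sc := (if Even c then a c - a p else a p - a c) with hsc
    set st := (if Even t then a t - a p else a p - a t) with hst
    rcases lt_trichotomy 0 sc with hp' | hz | hn
    · -- `sc > 0`: `τq < τc < τ'`
      have h1 : τq < τc := by nlinarith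
      have h2 : τc < τ' := by nlinarith
      nlinarith
    · exfalso; rw [← hz, zero_mul] at f1; linarith
    · have h1 : τc < τq := by nlinarith
      have h2 : τ' < τc := by nlinarith
      nlinarith
  · have htq' := hMq t hpt htc htq
    -- `t` correct at `τq` and at `τ'`, hence at `τc` in between
    rcases lt_trichotomy 0 (if Even c then a c - a p else a p - a c) with hp' | hz | hn
    · have h1 : τq < τc := by have := ec τq; nlinarith
      have h2 : τc < τ' := by have := ec τ'; nlinarith
      exact gap_pos_between a b h1.le h2.le htq' ht'
    · exfalso; have := ec τq; rw [← hz, zero_mul] at this; linarith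
    · have h1 : τc < τq := by have := ec τq; nlinarith
      have h2 : τ' < τc := by have := ec τ'; nlinarith
      exact gap_pos_between a b h2.le h1.le ht' htq'

/-- (G4) a killer `c` of `(p, q)` that is a partner of `p` belongs to the SAME slot as `q`. [folklore] -/
theorem sameSlot_of_killer {p q c : ℕ} (hpq : p < q) (hqc : q < c) (hAq : a p ≠ a q) (hAc : a p ≠ a c)
    (hbad : gap c (L a b p ((b q - b p) / (a p - a q))) (L a b c ((b q - b p) / (a p - a q))) < 0)
    (hMc : ∀ t, p < t → t < c → 0 < gap t (L a b p ((b c - b p) / (a p - a c))) (L a b t ((b c - b p) / (a p - a c)))) :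
    (0 < (if Even q then a q - a p else a p - a q)) ↔ (0 < (if Even c then a c - a p else a p - a c)) := by
  have hq : 0 < gap q (L a b p ((b c - b p) / (a p - a c))) (L a b q ((b c - b p) / (a p - a c))) := hMc q hpq hqc
  rw [gap_eq_slope_mul a b hAq] at hq
  rw [gap_eq_slope_mul a b hAc] at hbad
  set s := (if Even q then a q - a p else a p - a q) with hs
  set s' := (if Even c then a c - a p else a p - a c) with hs'
  set τ := (b q - b p) / (a p - a q)
  set τ' := (b c - b p) / (a p - a c)
  constructor
  · intro hsp
    have : 0 < τ' - τ := by
      by_contra hh; push Not at hh; nlinarith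
    nlinarith
  · intro hsp'
    have : 0 < τ' - τ := by
      by_contra hh; push Not at hh; nlinarith
    nlinarith

/-! ## 2. The (R)-clause reads the parity of the killer -/

/-- with `c` the killer of `q` (the first later index that is not correct, or `n + 1`), the (R)-clause of THEOREM T's events — an EVEN maximal
run of correct indices after `q` — says exactly that `c` and `q` have opposite parities. [folklore] -/
theorem rclause_iff_parity (G : ℕ → Prop) {n q c : ℕ} (hqc : q < c) (hcn : c ≤ n + 1)
    (hrun : ∀ t, q < t → t < c → G t) (hend : c = n + 1 ∨ (c ≤ n ∧ ¬ G c)) :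
    (∃ r, Even r ∧ q + r ≤ n ∧ (∀ t, q < t → t ≤ q + r → G t) ∧ (q + r = n ∨ ¬ G (q + r + 1))) ↔ ¬ (Even c ↔ Even q) := by
  constructor
  · rintro ⟨r, hre, hrn, hrrun, hrend⟩
    -- the run is forced: `q + r + 1 = c`
    have h1 : q + r + 1 ≥ c := by
      by_contra hh
      push Not at hh
      rcases hrend with h | h
      · omega
      · exact h (hrun _ (by omega) hh)
    have h2 : q + r + 1 ≤ c := by
      by_contra hh
      push Not at hh
      rcases hend with h | ⟨hcn', hbad⟩
      · omega
      · exact hbad (hrrun c hqc (by omega))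
    have hc : c = q + r + 1 := by omega
    rw [hc]
    intro hh
    have e : Even (q + r + 1) ↔ ¬ Even q := by
      rw [Nat.even_add_one, Nat.even_add]
      exact not_congr ⟨fun h => h.mpr hre, fun hq => ⟨fun _ => hre, fun _ => hq⟩⟩
    rw [e] at hh
    by_cases hq : Even q
    · exact (hh.mpr hq) hq
    · exact hq (hh.mp hq)
  · intro hpar
    refine ⟨c - q - 1, ?_, by omega, fun t h1 h2 => hrun t h1 (by omega), ?_⟩
    · -- parity
      rcases Nat.even_or_odd q with hq | hq <;> rcases Nat.even_or_odd c with hc | hc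
      · exact absurd ⟨fun _ => hq, fun _ => hc⟩ hpar
      · obtain ⟨i, hi⟩ := hq; obtain ⟨j, hj⟩ := hc; exact ⟨j - i, by omega⟩
      · obtain ⟨i, hi⟩ := hq; obtain ⟨j, hj⟩ := hc; exact ⟨j - i - 1, by omega⟩
      · exact absurd ⟨fun h => absurd h (Nat.not_even_iff_odd.mpr hc), fun h => absurd h (Nat.not_even_iff_odd.mpr hq)⟩ hpar
    · rcases hend with h | ⟨hcn', hbad⟩
      · left; omega
      · right; rw [show q + (c - q - 1) + 1 = c by omega]; exact hbad

/-! ## 3. Alternation: the next flip of a slot has the other parity -/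

/-- **FLIPS ALTERNATE ALONG A SLOT.**  Base line `p`; partners `k < q` of `p` (every line strictly between `p` and the partner is correct at their
vertex) in the SAME slot (same sign of the slope of their gap along `p`); `k` is an R-flip (the (R)-clause: its killer has the other parity) and
no partner of that slot strictly between `k` and `q` is an R-flip.  Then `q` and `k` have opposite parities.  (Consecutive partners of a slot kill
each other — `not_correct_of_sameSlot`, `partner_of_killer`, `sameSlot_of_killer` — so parity is transferred unchanged across non-flips and
flipped at `k`.) [folklore] -/
theorem parity_ne_of_nextFlip (n p k q : ℕ)
    (hslope : ∀ u v, u ≤ n → v ≤ n → u ≠ v → a u ≠ a v)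
    (hgp : ∀ u v t, u ≤ n → v ≤ n → t ≤ n → u ≠ v → t ≠ u → t ≠ v →
      L a b t ((b v - b u) / (a u - a v)) ≠ L a b u ((b v - b u) / (a u - a v)))
    (hk : p < k ∧ k ≤ n ∧ ∀ t, p < t → t < k →
      0 < gap t (L a b p ((b k - b p) / (a p - a k))) (L a b t ((b k - b p) / (a p - a k))))
    (hq : p < q ∧ q ≤ n ∧ ∀ t, p < t → t < q →
      0 < gap t (L a b p ((b q - b p) / (a p - a q))) (L a b t ((b q - b p) / (a p - a q))))
    (hkq : k < q)
    (hss : (0 < (if Even k then a k - a p else a p - a k)) ↔ (0 < (if Even q then a q - a p else a p - a q)))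
    (hflip : ∃ r, Even r ∧ k + r ≤ n ∧
      (∀ t, k < t → t ≤ k + r → 0 < gap t (L a b p ((b k - b p) / (a p - a k))) (L a b t ((b k - b p) / (a p - a k)))) ∧
      (k + r = n ∨ ¬ 0 < gap (k + r + 1) (L a b p ((b k - b p) / (a p - a k))) (L a b (k + r + 1) ((b k - b p) / (a p - a k)))))
    (hmin : ∀ o, p < o → o < q → k < o →
      (∀ t, p < t → t < o → 0 < gap t (L a b p ((b o - b p) / (a p - a o))) (L a b t ((b o - b p) / (a p - a o)))) →
      ((0 < (if Even o then a o - a p else a p - a o)) ↔ (0 < (if Even q then a q - a p else a p - a q))) →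
      ¬ ∃ r, Even r ∧ o + r ≤ n ∧
        (∀ t, o < t → t ≤ o + r → 0 < gap t (L a b p ((b o - b p) / (a p - a o))) (L a b t ((b o - b p) / (a p - a o)))) ∧
        (o + r = n ∨ ¬ 0 < gap (o + r + 1) (L a b p ((b o - b p) / (a p - a o))) (L a b (o + r + 1) ((b o - b p) / (a p - a o))))) :
    ¬ (Even q ↔ Even k) := by
  -- abbreviations: correctness at the vertex of `(p, o)`, the slot sign, the (R)-clause
  set Cor : ℕ → ℕ → Prop := fun o t => 0 < gap t (L a b p ((b o - b p) / (a p - a o))) (L a b t ((b o - b p) / (a p - a o))) with hCor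
  set Sl : ℕ → Prop := fun o => 0 < (if Even o then a o - a p else a p - a o) with hSl
  set Rc : ℕ → Prop := fun o => ∃ r, Even r ∧ o + r ≤ n ∧ (∀ t, o < t → t ≤ o + r → Cor o t) ∧ (o + r = n ∨ ¬ Cor o (o + r + 1)) with hRc
  have hpn : p ≤ n := by omega
  -- the claim for every same-slot partner `o` with `k < o ≤ q`, by strong induction on `o`
  have key : ∀ o, o ≤ q → p < o → (∀ t, p < t → t < o → Cor o t) → (Sl o ↔ Sl q) → k < o → ¬ (Even o ↔ Even k) := by
    intro o
    induction o using Nat.strong_induction_on with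
    | _ o ih =>
    intro hoq hpo hMo hso hko
    have hon : o ≤ n := by omega
    -- the previous partner of the slot
    set S := (range o).filter (fun o' => k ≤ o' ∧ p < o' ∧ (∀ t, p < t → t < o' → Cor o' t) ∧ (Sl o' ↔ Sl q)) with hS
    have hkS : k ∈ S := by
      rw [hS, mem_filter, mem_range]; exact ⟨hko, le_rfl, hk.1, hk.2.2, hss⟩
    have hSne : S.Nonempty := ⟨k, hkS⟩
    set om := S.max' hSne with hom_def
    have homS : om ∈ S := max'_mem S hSne
    rw [hS, mem_filter, mem_range] at homS
    obtain ⟨homo, hkom, hpom, hMom, hsom⟩ := homS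
    have hmaxS : ∀ o', o' ∈ S → o' ≤ om := fun o' ho' => le_max' S o' ho'
    have homn : om ≤ n := by omega
    have hAom : a p ≠ a om := hslope p om hpn homn (by omega)
    have hAo : a p ≠ a o := hslope p o hpn hon (by omega)
    -- (G2): `o` is incorrect at the vertex of `(p, om)`
    have hbadO : ¬ Cor om o := by
      have h := not_correct_of_sameSlot a b hAom hAo (hsom.trans hso.symm) (hMo om hpom homo)
      exact h
    -- the killer of `om`: the least later index incorrect at its vertex (it is at most `o`)
    have hex : ∃ t, om < t ∧ t ≤ n ∧ ¬ Cor om t := ⟨o, homo, hon, hbadO⟩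
    set c := Nat.find hex with hc_def
    obtain ⟨homc, hcn, hbadc⟩ := (Nat.find_spec hex : om < c ∧ c ≤ n ∧ ¬ Cor om c)
    have hco : c ≤ o := Nat.find_min' hex ⟨homo, hon, hbadO⟩
    have hrun : ∀ t, om < t → t < c → Cor om t := by
      intro t h1 h2
      by_contra hh
      exact Nat.find_min hex h2 ⟨h1, by omega, hh⟩
    -- `c = o`: otherwise `c` would be a partner of the slot strictly between `om` and `o`
    have hceq : c = o := by
      by_contra hne
      have hclt : c < o := lt_of_le_of_ne hco hne
      have hAc : a p ≠ a c := hslope p c hpn hcn (by omega)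
      have hbad' : gap c (L a b p ((b om - b p) / (a p - a om))) (L a b c ((b om - b p) / (a p - a om))) < 0 := by
        have hne0 : gap c (L a b p ((b om - b p) / (a p - a om))) (L a b c ((b om - b p) / (a p - a om))) ≠ 0 := by
          have hg := hgp p om c hpn homn hcn (by omega) (by omega) (by omega)
          unfold gap; split_ifs <;> [exact sub_ne_zero.mpr hg; exact sub_ne_zero.mpr (Ne.symm hg)]
        rcases lt_trichotomy (gap c (L a b p ((b om - b p) / (a p - a om))) (L a b c ((b om - b p) / (a p - a om)))) 0 with h | h | h
        · exact h
        · exact absurd h hne0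
        · exact absurd h hbadc
      have hPc : ∀ t, p < t → t < c → Cor c t :=
        partner_of_killer a b (by omega) homc hclt hAom hAc (fun t h1 h2 h3 => by
          rcases lt_or_gt_of_ne h3 with h | h
          · exact hMom t h1 h
          · exact hrun t h h2) hbad' hMo
      have hsc : Sl om ↔ Sl c := sameSlot_of_killer a b (by omega) homc hAom hAc hbad' hPc
      have hcS : c ∈ S := by
        rw [hS, mem_filter, mem_range]
        exact ⟨hclt, by omega, by omega, hPc, hsc.symm.trans hsom⟩
      have := hmaxS c hcS
      omega
    -- so `o` is the killer of `om`; the (R)-clause of `om` reads the parity of `o`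
    rw [hceq] at hrun
    have hRiff : Rc om ↔ ¬ (Even o ↔ Even om) :=
      rclause_iff_parity (Cor om) homo (by omega) hrun (Or.inr ⟨hon, hbadO⟩)
    by_cases homk : om = k
    · -- the previous partner is `k` itself, an R-flip
      have h1 : Rc k := hflip
      rw [← homk] at h1
      have h2 := hRiff.mp h1
      rw [homk] at h2
      exact h2
    · have hklt : k < om := lt_of_le_of_ne hkom (Ne.symm homk)
      have hnR : ¬ Rc om := hmin om hpom (by omega) hklt hMom hsom
      have hsame : (Even o ↔ Even om) := by by_contra hh; exact hnR (hRiff.mpr hh)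
      have ih' := ih om homo (by omega) hpom hMom hsom hklt
      intro hh
      exact ih' (hsame.symm.trans hh)
  exact key q le_rfl hq.1 hq.2.2 Iff.rfl hkq

end

end StaticPathFold

end Summit.ValiantsHypothesis.ValiantsHypothesis.Theorems.KPlusLogSqLaw
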